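import Summits.AtomisticToContinuum.HydrodynamicLimit.Theorems.TwoClocksEquilibriumFastWindowLDBirthT12ThalesGain
import Literature.Analysis.Calculus.PlanarPolarIntegral
import HarnessLib

/-!
# The Thales/Lambert representation of one hard-sphere collision, III: circle averages
# (helpers `t12_gainFst_circle`, `t12_gainSnd_circle` of the line `birth`, crux `TwoClocks.EquilibriumFastWindowLD`,
# stmt-AtomisticToContinuum-14440; infrastructure towards FF1 of the registered analytic sub-goal
# `t12_logLinearPreimage_and_dipoleModulus`)

Continuation of `…T12Thales`, `…T12ThalesGain`. Passing to polar coordinates `p = ρ(cos φ, sin φ)` in the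
Lambert disc turns the disc forms `t12_gainFst/Snd_disc` of the gain term into the CIRCLE-AVERAGE form
of the plan (FACT F, §2; FF1, §6), with the thermal partner `w` resolved: for `v, w ∈ ℝ³`, `u = v - w`,
`û = u/‖u‖`, the tree's measurable orthonormal frame `(e₁ û, e₂ û, û)` (`Lambert.e₁/e₂`,
`Literature/Analysis/FluidPDE/DicedHardSphereDynamics.lean`) and every measurable `F ≥ 0` on `ℝ³`,

  `∫_{S²} (u·ω)₊ F(v') dσ(ω) = ‖u‖ ∫₀¹ ρ ∫_{-π}^{π} F(w + ρ² u - ‖u‖ ρ √(1-ρ²) (cos φ e₁ û + sin φ e₂ û)) dφ dρ`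
  `∫_{S²} (u·ω)₊ F(w') dσ(ω) = ‖u‖ ∫₀¹ ρ ∫_{-π}^{π} F(w + (1-ρ²) u + ‖u‖ ρ √(1-ρ²) (cos φ e₁ û + sin φ e₂ û)) dφ dρ`

(registered helpers `t12_gainFst_circle`, `t12_gainSnd_circle`; `lintegral` identities, exact for all
`v, w`). For fixed `ρ` the inner integral runs over the circle of the Thales sphere of `[w, v]` at
distance `ρ‖u‖` (resp. `√(1-ρ²)‖u‖`) from `w`: writing `‖u‖ρ Ω` with
`Ω = ρ û - √(1-ρ²)(cos φ e₁ û + sin φ e₂ û) ∈ S²`, `⟪Ω, û⟫ = ρ`, the inner integral is `2π` times the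
normalised average `A_ρ` of `x ↦ F(w + ‖u‖ρ x)` over the circle `{Ω ∈ S² : ⟪Ω, û⟫ = ρ}`, so that
`∫ (u·ω)₊ F(v') dσ = π‖u‖ ∫₀¹ 2ρ (A_ρ F(w + ‖u‖ρ ·)) dρ` — at `w = 0`, `‖u‖ = s` exactly the far-field
operator `(ν⁻¹K₂^∞)` of FACT F (own piece; the partner piece is the same after `ρ ↦ √(1-ρ²)`, which
preserves `2ρ dρ`). What is left for FF1 is only the comparison of `w ∼ M` with `w = 0` (Gaussian
concentration), not the collision geometry.

Bochner forms for real `ψ` measurable and bounded on bounded sets (`integral_hardSphereKernel_mul_comp_collide_fst_circle`,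
`…_snd_circle`), e.g. `ψ` of Gaussian growth as in `kernelAction_eq_pieces_of_gaussGrowth`. Also: polar
coordinates on the unit disc of `ℝ²` (`lintegral_ball_eq_lintegral_polar`, `integral_ball_eq_integral_polar`,
from Mathlib's `(l)integral_comp_polarCoord_symm` on `ℝ × ℝ` transported by the volume-preserving chart
`(a, b) ↦ !₂[a, b]` of `Literature/Analysis/Calculus/PlanarPolarIntegral.lean`). All statements are [folklore].
-/

noncomputable section

open MeasureTheory Real Set Filter Metric
open scoped ENNReal BigOperators InnerProductSpace
namespace Summit.AtomisticToContinuum.HydrodynamicLimit.Theorems.ClampedCorrectorBirth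

open Literature.Analysis.FluidPDE Literature.MathematicalPhysics.KineticTheory Literature.Analysis.Calculus

/-! ### Polar coordinates on the unit disc -/

/-- The frame embedding of a plane point in polar coordinates:
`embed ω !₂[ρ cos φ, ρ sin φ] = ρ (cos φ e₁ ω + sin φ e₂ ω)`. [folklore] -/
theorem embed_toLp_vec_polar (ω : EuclideanSpace ℝ (Fin 3)) (ρ φ : ℝ) :
    Lambert.embed ω (WithLp.toLp 2 ![ρ * cos φ, ρ * sin φ]) =
      ρ • (cos φ • Lambert.e₁ ω + sin φ • Lambert.e₂ ω) := by
  simp only [Lambert.embed, Matrix.cons_val_zero, Matrix.cons_val_one, smul_add, smul_smul]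

/-- The polar rectangle of the unit disc inside the polar target. [folklore] -/
theorem polarCoord_target_inter_Iio_one :
    (Ioi (0:ℝ) ×ˢ Ioo (-π) π) ∩ Iio (1:ℝ) ×ˢ (univ : Set ℝ) = Ioo (0:ℝ) 1 ×ˢ Ioo (-π) π := by
  rw [Set.prod_inter_prod, inter_univ, Ioi_inter_Iio]

/-- On the polar target, `c(ρ) 1_{B(0,1)}(p) G(p)` at `p = !₂[ρ cos φ, ρ sin φ]` is the indicator of `ρ < 1`
times `c(ρ) G(!₂[ρ cos φ, ρ sin φ])`, for any weight `c` killing `0`. [folklore] -/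
theorem eqOn_polarCoord_target_indicator_ball {G : Type*} [Zero G] {c : ℝ → G → G}
    (hc : ∀ r, c r 0 = 0) (g : EuclideanSpace ℝ (Fin 2) → G) :
    EqOn (fun q : ℝ × ℝ => c q.1 ((ball (0 : EuclideanSpace ℝ (Fin 2)) 1).indicator g
        (WithLp.toLp 2 ![(polarCoord.symm q).1, (polarCoord.symm q).2])))
      ((Iio (1:ℝ) ×ˢ (univ : Set ℝ)).indicator
        fun q => c q.1 (g (WithLp.toLp 2 ![q.1 * cos q.2, q.1 * sin q.2]))) polarCoord.target := by
  intro q hq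
  rw [polarCoord_target] at hq
  have hq1 : 0 < q.1 := hq.1
  simp only [polarCoord_symm_apply]
  by_cases h1 : q.1 < 1
  · rw [indicator_of_mem (mem_ball_zero_iff.2 (by rw [norm_toLp_polar hq1.le]; exact h1)),
      indicator_of_mem (show q ∈ Iio (1:ℝ) ×ˢ (univ : Set ℝ) from ⟨h1, mem_univ _⟩)]
  · rw [indicator_of_notMem (fun h => h1 (by
        have := mem_ball_zero_iff.1 h; rwa [norm_toLp_polar hq1.le] at this)),
      indicator_of_notMem (fun h : q ∈ Iio (1:ℝ) ×ˢ (univ : Set ℝ) => h1 h.1), hc]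

/-- **Polar coordinates on the unit disc** (`lintegral` form): for measurable `G ≥ 0` on `ℝ²`,
`∫_{‖p‖<1} G(p) dp = ∫₀¹ ρ ∫_{-π}^{π} G(!₂[ρ cos φ, ρ sin φ]) dφ dρ`. Proof: Mathlib's
`lintegral_comp_polarCoord_symm` on `ℝ × ℝ`, transported by the volume-preserving Cartesian chart
(`measurePreserving_toLp_fin_two`), and Tonelli on `(0, 1) × (-π, π)`. [folklore] -/
theorem lintegral_ball_eq_lintegral_polar {G : EuclideanSpace ℝ (Fin 2) → ℝ≥0∞} (hG : Measurable G) :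
    ∫⁻ p in ball (0 : EuclideanSpace ℝ (Fin 2)) 1, G p =
      ∫⁻ ρ in Ioo (0:ℝ) 1, ENNReal.ofReal ρ *
        ∫⁻ φ in Ioo (-π) π, G (WithLp.toLp 2 ![ρ * cos φ, ρ * sin φ]) := by
  rw [← lintegral_indicator measurableSet_ball,
    ← measurePreserving_toLp_fin_two.lintegral_comp (hG.indicator measurableSet_ball),
    ← lintegral_comp_polarCoord_symm]
  have hpt := eqOn_polarCoord_target_indicator_ball (c := fun r x => ENNReal.ofReal r • x)
    (fun r => smul_zero _) G
  rw [setLIntegral_congr_fun polarCoord.open_target.measurableSet hpt,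
    lintegral_indicator (measurableSet_Iio.prod MeasurableSet.univ), Measure.restrict_restrict
      (measurableSet_Iio.prod MeasurableSet.univ), polarCoord_target, inter_comm,
    polarCoord_target_inter_Iio_one, Measure.volume_eq_prod, ← Measure.prod_restrict, lintegral_prod _ ?_]
  · refine setLIntegral_congr_fun measurableSet_Ioo fun ρ _ => ?_
    dsimp only
    simp_rw [smul_eq_mul]
    exact lintegral_const_mul _ (hG.comp (by fun_prop))
  · exact Measurable.aemeasurable (by
      refine (ENNReal.measurable_ofReal.comp measurable_fst).smul (hG.comp ?_)
      fun_prop)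

/-- **Polar coordinates on the unit disc, Bochner form**: for `g` integrable on the unit disc of `ℝ²`
(Banach-valued), `∫_{‖p‖<1} g(p) dp = ∫₀¹ ρ ∫_{-π}^{π} g(!₂[ρ cos φ, ρ sin φ]) dφ dρ`. Integrability of the
polar integrand on `(0, 1) × (-π, π)` comes from `integrableOn_polarCoord_target`
(`PlanarPolarIntegral.lean`) applied to `1_{B(0,1)} g`; then Fubini. [folklore] -/
theorem integral_ball_eq_integral_polar {G : Type*} [NormedAddCommGroup G] [NormedSpace ℝ G]
    {g : EuclideanSpace ℝ (Fin 2) → G} (hg : IntegrableOn g (ball (0 : EuclideanSpace ℝ (Fin 2)) 1)) :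
    ∫ p in ball (0 : EuclideanSpace ℝ (Fin 2)) 1, g p =
      ∫ ρ in Ioo (0:ℝ) 1, ρ • ∫ φ in Ioo (-π) π, g (WithLp.toLp 2 ![ρ * cos φ, ρ * sin φ]) := by
  have hpt := eqOn_polarCoord_target_indicator_ball (c := fun r x => r • x) (fun r => smul_zero _) g
  -- integrability of the polar integrand on the polar rectangle
  have hint : IntegrableOn (fun q : ℝ × ℝ => q.1 • g (WithLp.toLp 2 ![q.1 * cos q.2, q.1 * sin q.2]))
      (Ioo (0:ℝ) 1 ×ˢ Ioo (-π) π) (volume.prod volume) := by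
    have h1 : Integrable fun q : ℝ × ℝ =>
        (ball (0 : EuclideanSpace ℝ (Fin 2)) 1).indicator g (WithLp.toLp 2 ![q.1, q.2]) :=
      (integrable_comp_toLp_fin_two_iff _).2 ((integrable_indicator_iff measurableSet_ball).2 hg)
    have h3 : IntegrableOn ((Iio (1:ℝ) ×ˢ (univ : Set ℝ)).indicator fun q : ℝ × ℝ =>
        q.1 • g (WithLp.toLp 2 ![q.1 * cos q.2, q.1 * sin q.2])) polarCoord.target volume :=
      (integrableOn_polarCoord_target h1).congr_fun (fun q hq => hpt hq)
        polarCoord.open_target.measurableSet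
    have h4 := (integrable_indicator_iff (measurableSet_Iio.prod MeasurableSet.univ)).1 h3
    rw [IntegrableOn, Measure.restrict_restrict (measurableSet_Iio.prod MeasurableSet.univ),
      polarCoord_target, inter_comm, polarCoord_target_inter_Iio_one] at h4
    rw [← Measure.volume_eq_prod]
    exact h4
  rw [← integral_indicator measurableSet_ball,
    ← measurePreserving_toLp_fin_two.integral_comp measurableEmbedding_toLp_fin_two,
    ← integral_comp_polarCoord_symm, setIntegral_congr_fun polarCoord.open_target.measurableSet hpt,
    setIntegral_indicator (measurableSet_Iio.prod MeasurableSet.univ), polarCoord_target,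
    polarCoord_target_inter_Iio_one, Measure.volume_eq_prod, setIntegral_prod _ hint]
  refine setIntegral_congr_fun measurableSet_Ioo fun ρ _ => ?_
  exact integral_smul _ _

/-! ### The gain term as an integral of circle averages -/

variable {v w : EuclideanSpace ℝ (Fin 3)}

/-- **Registered helper `t12_gainFst_circle` — the own gain term as an integral of circle averages on
the Thales sphere.** For all `v, w ∈ ℝ³` (`u = v - w`, `û = u/‖u‖`, frame `e₁ û, e₂ û`) and measurable
`F ≥ 0`:
`∫_{S²} (u·ω)₊ F(v') dσ(ω) = ‖u‖ ∫₀¹ ρ ∫_{-π}^{π} F(w + ρ² u - ‖u‖ρ√(1-ρ²)(cos φ e₁ û + sin φ e₂ û)) dφ dρ`,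
`v' = (collide ω (v, w)).1`. The inner integral is `2π` times the average of `F(w + ‖u‖ρ ·)` over the
circle `{Ω ∈ S² : ⟪Ω, û⟫ = ρ}` (the zonal circle average `A_ρ` of the plan), so this is
`π‖u‖ ∫₀¹ 2ρ A_ρ(…) dρ`: the `w`-resolved far-field operator of FACT F (own piece). [folklore] -/
theorem t12_gainFst_circle : ∀ (v w : EuclideanSpace ℝ (Fin 3)) (F : EuclideanSpace ℝ (Fin 3) → ENNReal), Measurable F → ∫⁻ ω, ENNReal.ofReal (Literature.MathematicalPhysics.KineticTheory.hardSphereKernel (v, w) ω) * F (Literature.MathematicalPhysics.KineticTheory.collide ω (v, w)).1 ∂Literature.MathematicalPhysics.KineticTheory.sphereMeasure = ENNReal.ofReal ‖v - w‖ * ∫⁻ ρ in Set.Ioo (0 : ℝ) 1, ENNReal.ofReal ρ * ∫⁻ φ in Set.Ioo (-Real.pi) Real.pi, F (w + (ρ ^ 2) • (v - w) - (‖v - w‖ * ρ * Real.sqrt (1 - ρ ^ 2)) • (Real.cos φ • Literature.Analysis.FluidPDE.Lambert.e₁ (‖v - w‖⁻¹ • (v - w)) + Real.sin φ • Literature.Analysis.FluidPDE.Lambert.e₂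 (‖v - w‖⁻¹ • (v - w)))) := by
  intro v w F hF
  have hG : Measurable fun p : EuclideanSpace ℝ (Fin 2) => F (w + (‖p‖ ^ 2) • (v - w) -
      (‖v - w‖ * √(1 - ‖p‖ ^ 2)) • Lambert.embed (‖v - w‖⁻¹ • (v - w)) p) := by
    refine hF.comp ?_
    unfold Lambert.embed; fun_prop
  rw [lintegral_hardSphereKernel_mul_comp_collide_fst v w hF, lintegral_ball_eq_lintegral_polar hG]
  congr 1
  refine setLIntegral_congr_fun measurableSet_Ioo fun ρ hρ => ?_
  congr 1
  refine lintegral_congr fun φ => ?_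
  rw [norm_toLp_polar hρ.1.le, embed_toLp_vec_polar, smul_smul, mul_right_comm]

/-- **Registered helper `t12_gainSnd_circle` — the partner gain term as an integral of circle averages
on the Thales sphere.** For all `v, w ∈ ℝ³` and measurable `F ≥ 0`:
`∫_{S²} (u·ω)₊ F(w') dσ(ω) = ‖u‖ ∫₀¹ ρ ∫_{-π}^{π} F(w + (1-ρ²) u + ‖u‖ρ√(1-ρ²)(cos φ e₁ û + sin φ e₂ û)) dφ dρ`,
`w' = (collide ω (v, w)).2`: for fixed `ρ` the circle of the Thales sphere at distance `√(1-ρ²)‖u‖` from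
`w` (substituting `ρ ↦ √(1-ρ²)`, which preserves `ρ dρ` on `(0, 1)`, gives the same operator as for the
own particle: the factor `4ρ = 2ρ + 2ρ` of FACT F). [folklore] -/
theorem t12_gainSnd_circle : ∀ (v w : EuclideanSpace ℝ (Fin 3)) (F : EuclideanSpace ℝ (Fin 3) → ENNReal), Measurable F → ∫⁻ ω, ENNReal.ofReal (Literature.MathematicalPhysics.KineticTheory.hardSphereKernel (v, w) ω) * F (Literature.MathematicalPhysics.KineticTheory.collide ω (v, w)).2 ∂Literature.MathematicalPhysics.KineticTheory.sphereMeasure = ENNReal.ofReal ‖v - w‖ * ∫⁻ ρ in Set.Ioo (0 : ℝ) 1, ENNReal.ofReal ρ * ∫⁻ φ in Set.Ioo (-Real.pi) Real.pi, F (w + (1 - ρ ^ 2) • (v - w) + (‖v - w‖ * ρ * Real.sqrt (1 - ρ ^ 2)) • (Real.cos φ • Literature.Analysis.FluidPDE.Lambert.e₁ (‖v - w‖⁻¹ • (v - w)) + Real.sin φ • Literature.Analysis.FluidPDE.Lambert.e₂ (‖v - w‖⁻¹ • (v - w)))) := by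
  intro v w F hF
  have hG : Measurable fun p : EuclideanSpace ℝ (Fin 2) => F (w + (1 - ‖p‖ ^ 2) • (v - w) +
      (‖v - w‖ * √(1 - ‖p‖ ^ 2)) • Lambert.embed (‖v - w‖⁻¹ • (v - w)) p) := by
    refine hF.comp ?_
    unfold Lambert.embed; fun_prop
  rw [lintegral_hardSphereKernel_mul_comp_collide_snd v w hF, lintegral_ball_eq_lintegral_polar hG]
  congr 1
  refine setLIntegral_congr_fun measurableSet_Ioo fun ρ hρ => ?_
  congr 1
  refine lintegral_congr fun φ => ?_
  rw [norm_toLp_polar hρ.1.le, embed_toLp_vec_polar, smul_smul, mul_right_comm]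


/-! ### Bochner forms for locally bounded test functions -/

/-- The Thales parametrisations stay in the ball of radius `‖w‖ + 2‖u‖`: for `‖p‖ < 1`, `0 ≤ a ≤ 1`,
`‖w + a u ± ‖u‖√(1-‖p‖²) embed û p‖ ≤ ‖w‖ + 2‖u‖` (`v ≠ w`). [folklore] -/
theorem norm_thales_point_le (hvw : v ≠ w) {p : EuclideanSpace ℝ (Fin 2)} (hp : ‖p‖ < 1) {a : ℝ}
    (ha0 : 0 ≤ a) (ha1 : a ≤ 1) (ε : ℝ) (hε : |ε| = 1) :
    ‖w + a • (v - w) + (ε * (‖v - w‖ * √(1 - ‖p‖ ^ 2))) • Lambert.embed (‖v - w‖⁻¹ • (v - w)) p‖ ≤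
      ‖w‖ + 2 * ‖v - w‖ := by
  have hû : ‖‖v - w‖⁻¹ • (v - w)‖ = 1 := norm_smul_inv_norm (sub_ne_zero.2 hvw)
  have hE : ‖Lambert.embed (‖v - w‖⁻¹ • (v - w)) p‖ ≤ 1 := by rw [Lambert.norm_embed hû]; exact hp.le
  have hsq : √(1 - ‖p‖ ^ 2) ≤ 1 := by
    rw [sqrt_le_one]; nlinarith [norm_nonneg p]
  have h1 : ‖a • (v - w)‖ ≤ ‖v - w‖ := by
    rw [norm_smul, Real.norm_of_nonneg ha0]
    exact mul_le_of_le_one_left (norm_nonneg _) ha1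
  have h2 : ‖(ε * (‖v - w‖ * √(1 - ‖p‖ ^ 2))) • Lambert.embed (‖v - w‖⁻¹ • (v - w)) p‖ ≤ ‖v - w‖ := by
    rw [norm_smul, Real.norm_eq_abs, abs_mul, hε, one_mul, abs_of_nonneg (by positivity)]
    calc ‖v - w‖ * √(1 - ‖p‖ ^ 2) * ‖Lambert.embed (‖v - w‖⁻¹ • (v - w)) p‖
        ≤ ‖v - w‖ * 1 * 1 := by gcongr
      _ = ‖v - w‖ := by ring
  linarith [norm_add_le (w + a • (v - w))
    ((ε * (‖v - w‖ * √(1 - ‖p‖ ^ 2))) • Lambert.embed (‖v - w‖⁻¹ • (v - w)) p), norm_add_le w (a • (v - w))]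

/-- **The own gain term as an integral of circle averages, Bochner form.** For `v, w ∈ ℝ³` and real
`ψ` measurable and bounded on bounded sets (e.g. of Gaussian growth):
`∫_{S²} (u·ω)₊ ψ(v') dσ(ω) = ‖u‖ ∫₀¹ ρ ∫_{-π}^{π} ψ(w + ρ² u - ‖u‖ρ√(1-ρ²)(cos φ e₁ û + sin φ e₂ û)) dφ dρ`.
[folklore] -/
theorem integral_hardSphereKernel_mul_comp_collide_fst_circle (v w : EuclideanSpace ℝ (Fin 3))
    {ψ : EuclideanSpace ℝ (Fin 3) → ℝ} (hψ : Measurable ψ) (hb : ∀ R : ℝ, ∃ C : ℝ, ∀ x, ‖x‖ ≤ R → |ψ x| ≤ C) :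
    ∫ ω, hardSphereKernel (v, w) ω * ψ (collide ω (v, w)).1 ∂sphereMeasure =
      ‖v - w‖ * ∫ ρ in Ioo (0:ℝ) 1, ρ * ∫ φ in Ioo (-π) π,
        ψ (w + (ρ ^ 2) • (v - w) - (‖v - w‖ * ρ * √(1 - ρ ^ 2)) •
          (cos φ • Lambert.e₁ (‖v - w‖⁻¹ • (v - w)) + sin φ • Lambert.e₂ (‖v - w‖⁻¹ • (v - w)))) := by
  rcases eq_or_ne v w with rfl | hvw
  · simp [hardSphereKernel]
  have hP : Measurable fun p : EuclideanSpace ℝ (Fin 2) => w + (‖p‖ ^ 2) • (v - w) -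
      (‖v - w‖ * √(1 - ‖p‖ ^ 2)) • Lambert.embed (‖v - w‖⁻¹ • (v - w)) p := by
    unfold Lambert.embed; fun_prop
  obtain ⟨C, hC⟩ := hb (‖w‖ + 2 * ‖v - w‖)
  have hint : IntegrableOn (fun p : EuclideanSpace ℝ (Fin 2) => ψ (w + (‖p‖ ^ 2) • (v - w) -
      (‖v - w‖ * √(1 - ‖p‖ ^ 2)) • Lambert.embed (‖v - w‖⁻¹ • (v - w)) p))
      (ball (0 : EuclideanSpace ℝ (Fin 2)) 1) := by
    refine Measure.integrableOn_of_bounded (M := C) measure_ball_lt_top.ne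
      (hψ.comp hP).aestronglyMeasurable ((ae_restrict_iff' measurableSet_ball).2
        (Eventually.of_forall fun p hp => ?_))
    rw [Real.norm_eq_abs]
    refine hC _ ?_
    have h := norm_thales_point_le hvw (mem_ball_zero_iff.1 hp) (sq_nonneg ‖p‖)
      (by nlinarith [norm_nonneg p, mem_ball_zero_iff.1 hp]) (-1) (by norm_num)
    rwa [neg_one_mul, neg_smul, ← sub_eq_add_neg] at h
  rw [t12_gainFst_disc v w ψ hψ, integral_ball_eq_integral_polar hint]
  congr 1
  refine setIntegral_congr_fun measurableSet_Ioo fun ρ hρ => ?_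
  rw [smul_eq_mul]
  congr 1
  refine integral_congr_ae (Eventually.of_forall fun φ => ?_)
  dsimp only
  rw [norm_toLp_polar hρ.1.le, embed_toLp_vec_polar, smul_smul, mul_right_comm]

/-- **The partner gain term as an integral of circle averages, Bochner form.** For `v, w ∈ ℝ³` and real
`ψ` measurable and bounded on bounded sets:
`∫_{S²} (u·ω)₊ ψ(w') dσ(ω) = ‖u‖ ∫₀¹ ρ ∫_{-π}^{π} ψ(w + (1-ρ²) u + ‖u‖ρ√(1-ρ²)(cos φ e₁ û + sin φ e₂ û)) dφ dρ`.
[folklore] -/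
theorem integral_hardSphereKernel_mul_comp_collide_snd_circle (v w : EuclideanSpace ℝ (Fin 3))
    {ψ : EuclideanSpace ℝ (Fin 3) → ℝ} (hψ : Measurable ψ) (hb : ∀ R : ℝ, ∃ C : ℝ, ∀ x, ‖x‖ ≤ R → |ψ x| ≤ C) :
    ∫ ω, hardSphereKernel (v, w) ω * ψ (collide ω (v, w)).2 ∂sphereMeasure =
      ‖v - w‖ * ∫ ρ in Ioo (0:ℝ) 1, ρ * ∫ φ in Ioo (-π) π,
        ψ (w + (1 - ρ ^ 2) • (v - w) + (‖v - w‖ * ρ * √(1 - ρ ^ 2)) •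
          (cos φ • Lambert.e₁ (‖v - w‖⁻¹ • (v - w)) + sin φ • Lambert.e₂ (‖v - w‖⁻¹ • (v - w)))) := by
  rcases eq_or_ne v w with rfl | hvw
  · simp [hardSphereKernel]
  have hP : Measurable fun p : EuclideanSpace ℝ (Fin 2) => w + (1 - ‖p‖ ^ 2) • (v - w) +
      (‖v - w‖ * √(1 - ‖p‖ ^ 2)) • Lambert.embed (‖v - w‖⁻¹ • (v - w)) p := by
    unfold Lambert.embed; fun_prop
  obtain ⟨C, hC⟩ := hb (‖w‖ + 2 * ‖v - w‖)
  have hint : IntegrableOn (fun p : EuclideanSpace ℝ (Fin 2) => ψ (w + (1 - ‖p‖ ^ 2) • (v - w) +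
      (‖v - w‖ * √(1 - ‖p‖ ^ 2)) • Lambert.embed (‖v - w‖⁻¹ • (v - w)) p))
      (ball (0 : EuclideanSpace ℝ (Fin 2)) 1) := by
    refine Measure.integrableOn_of_bounded (M := C) measure_ball_lt_top.ne
      (hψ.comp hP).aestronglyMeasurable ((ae_restrict_iff' measurableSet_ball).2
        (Eventually.of_forall fun p hp => ?_))
    rw [Real.norm_eq_abs]
    refine hC _ ?_
    have h := norm_thales_point_le hvw (mem_ball_zero_iff.1 hp)
      (by nlinarith [norm_nonneg p, mem_ball_zero_iff.1 hp] : (0:ℝ) ≤ 1 - ‖p‖ ^ 2)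
      (by nlinarith [norm_nonneg p]) 1 (by norm_num)
    rwa [one_mul] at h
  rw [t12_gainSnd_disc v w ψ hψ, integral_ball_eq_integral_polar hint]
  congr 1
  refine setIntegral_congr_fun measurableSet_Ioo fun ρ hρ => ?_
  rw [smul_eq_mul]
  congr 1
  refine integral_congr_ae (Eventually.of_forall fun φ => ?_)
  dsimp only
  rw [norm_toLp_polar hρ.1.le, embed_toLp_vec_polar, smul_smul, mul_right_comm]

end Summit.AtomisticToContinuum.HydrodynamicLimit.Theorems.ClampedCorrectorBirth

end
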